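/-
Copyright (c) 2026 the pub-hodgecm-mathlib formalisation cell (harness21).  Prover seats hodgecm-mathlib-LH4-p09 (g10) (statement, design, ★ prelims; VALVE hand) and
hodgecm-mathlib-K2Liu-p14 (g5) (proof; K1b∕ρ desk, DESK WORD #9 (2) fallback pen after LH4-p09's handoff 2026-09-05T01:29Z), Track B «K2-LIT» ∕ hLiu418 socket #41 KIND 1,
package (K1b-♮), letter (P-dec): THE ONE-FRAME ASSEMBLY — the (P-dec) head's letter `hdecF₀` (★ `K2LiuKindOneLineDecay.wdec_of_oneFrame`, LH4-p14 (g8)) from ONE block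
letter on `h`, all (dec-3) faces discharged by name.  THEOREMS ONLY.
-/
import Summits.HodgeConjecture.HodgeConjecture.Theorems.K2LiuKindOneLineDecayOneFrame          -- ★ p864248: the rate-`π` assembly (+ §0 entry bounds, all ★ inputs transitively; ★ p864567 (ρ4-𝔸) ED. 3 `_of_cover_rate` via the tree)
import Summits.HodgeConjecture.HodgeConjecture.Theorems.K2LiuKindOneLineCornerGramBoundAdelic    -- ★ p864567 ED. 3: `exists_exp_neg_sum_le_exp_neg_height_of_cover_rate` (Gaussian at a payer-chosen rate)
import HarnessLib

/-!
# Crux `HLiu418`, socket #41, KIND 1 — (P-dec) THE ONE-FRAME ASSEMBLY AT A PAYER-CHOSEN GAUSSIAN RATE `K2LiuKindOneLineDecayOneFrameRate`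

Cell `hodgecm-mathlib`, crux item hLiu418 = `stmt-HodgeConjecture-24832` (helper lane `--supports … --as helper`, count-neutral); squad K2 ∕ K2Liu; K1b desk K2Liu-p14 (g5)
DESK WORD #13 (2026-09-05T02:26Z): REPAIR (R2) of ★ p864248 `K2LiuKindOneLineDecayOneFrame.hdecF₀_of_blockLetter` after LH4-p14 (g8)'s «≠¹» 02:23:35Z and LH4-p09 (g11)'s
mover-class note — the block letter of ★ p864248 FROZE the Gaussian rate `π` while quantifying over ALL admissible (non-unitary) movers, which no payer can serve (`ρ_σ` moves
by factors `≤ 16M²` across movers while the left side is mover-free).  HERE the letter `hBL₁` carries a PAYER-CHOSEN rate `cπ > 0` at the `z`-level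
(`∃ (C a a₂ κ₁ κ₂ Ng r cπ) …, … 0 < cπ ∧ …, … · (1 + |σ♭|_σ ρ_σ)^{Ng} · e^{−cπ |σ♭|_σ ρ_σ}`), payable with `cπ := π∕(16M²)` from the canonical reading; the conclusion is
★ p863980 `wdec_of_oneFrame`'s `hdecF₀` VERBATIM (`Nb := 0`).  PROOF = ★ p864248's, with §0 `perPlace_le_rate` (★ p864121 `perPlace_le` at rate `cπ`, the polynomial
absorbed into `e^{−(cπ∕2)·}` by ★ `one_add_pow_mul_exp_neg_le`) and the Gaussian against the height by ★ p864567 (ρ4-𝔸) ED. 3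
`exists_exp_neg_sum_le_exp_neg_height_of_cover_rate` at rate `cπ∕2` (LH4-p14 (g8)); the entry bounds `Vb` are ★ p864248 §0 by name.  THEOREMS ONLY.
HONEST LABEL.  Count-neutral helper, hypothesis-first in `hBL₁` (payers: (β) arch half LH4-p09 (g11) + the KW-fin residue + ★ (dec-1)); closes no socket: `HC_CM` is proved
only modulo the 7 printed citations (2 remaining named inputs: hLiu418 = `stmt-HodgeConjecture-24832`, h413 = `stmt-HodgeConjecture-24833`) until rung 0 closes.
-/

set_option autoImplicit false
set_option linter.dupNamespace false -- the mandated namespace repeats `HodgeConjecture.HodgeConjecture`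

noncomputable section

open scoped Matrix ENNReal NNReal ComplexConjugate BigOperators
open scoped Classical
open NumberField NumberField.InfinitePlace IsDedekindDomain MeasureTheory MeasureTheory.Measure
open Literature.NumberTheory.Automorphic Literature.NumberTheory.Automorphic.UnitaryGroup Literature.NumberTheory.GaloisRepresentations
open Literature.NumberTheory.GelbartRogawski1991 Literature.NumberTheory.GelbartRogawski1991.GRConstruction
open Literature.NumberTheory.GelbartRogawski1991.AdaptedBlocks
open Literature.NumberTheory.K2Lit.SiegelDoubled Literature.MeasureTheory.Group
open UnitaryDualPair

namespace Summit.HodgeConjecture.HodgeConjecture.Cruxes.HLiu418.K2LiuKindOneLineDecayOneFrameRate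

open K2LiuSiegelUnipotentFourierDefs K2LiuSiegelUnipotentCharacters K2LiuUnipotentCoveringWeight K2LiuSiegelFourierCoeffDelta
open K2LiuSiegelRationalLeviDecomposition K2LiuSiegelMiddleCellSortedPattern K2LiuSiegelMiddleCellLeviCriterion K2LiuSiegelBruhatMiddleCellDelta
open K2LiuRankOneCornerIndexTransport (exists_rat_levi_blocks_levi_map conj_index_eq_single)
open K2LiuKindOneLineCornerGramBoundAdelic (exists_exp_neg_sum_le_exp_neg_height)
open K2LiuKindOneLineCornerBlockFaces (corner_row_sq_eq norm_det_rpow_le blockData_of_decomp)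
open K2LiuKindOneLineDecayLowerPowerFace (rpow_le_rpow_abs rpow_le_rpow_of_abs_le one_le_of_le_of_inv_le inv_sum_sq_vecMul_le sum_sq_vecMul_pos norm_map_row_apply_eq_one)
open K2LiuSiegelEisensteinKindWBlockAtPoint (exists_blockDecomposition_archAt)
open K2LiuSiegelEisensteinKindWLocalExponents (one_add_pow_mul_exp_neg_le)
open K2LiuSiegelEisensteinKindWDecay (inv_apply_det_le apply_entry_le_norm)
open K2LiuIwasawaHeightLatticeSumBound (exists_adelicHeightGL_floor)
open K2LiuKindOneLineDecayOneFrame (norm_embedding_ratio_le norm_embedding_le_one_add_of_cases one_add_mul_le_pow_mul_pow)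
open K2LiuArchBlockHeightBound (norm_mul_apply_le)

/-! ## §0 The per-place factor at a payer-chosen Gaussian rate (★ p864121 `perPlace_le` with `π ↦ cπ`) -/

/-- **THE POLYNOMIAL INTO THE GAUSSIAN AT RATE `cπ`**: `(1 + x)^{Ng} · e^{−cπ x} ≤ K(Ng, cπ) · e^{−(cπ∕2) x}` for `x ≥ 0`, `cπ > 0`, any real `Ng`
(`K = 2^{⌈Ng⌉}(1 + ⌈Ng⌉!·(2∕cπ)^{⌈Ng⌉})`; ★ `one_add_pow_mul_exp_neg_le` at `H := 1`). [cite: MoeglinWaldspurger1995, II.1.7] -/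
theorem one_add_rpow_mul_exp_neg_le_rate {x cπ : ℝ} (hx : 0 ≤ x) (hcπ : 0 < cπ) (Ng : ℝ) :
    (1 + x) ^ Ng * Real.exp (-(cπ * x)) ≤
      ((2 : ℝ) ^ ⌈Ng⌉₊ * (1 + ((⌈Ng⌉₊).factorial : ℝ) * (2 / cπ) ^ ⌈Ng⌉₊)) * Real.exp (-(cπ / 2 * x)) := by
  have h1 : (1 + x) ^ Ng ≤ (1 + x) ^ ⌈Ng⌉₊ := by
    calc (1 + x) ^ Ng ≤ (1 + x) ^ ((⌈Ng⌉₊ : ℕ) : ℝ) := Real.rpow_le_rpow_of_exponent_le (by linarith) (Nat.le_ceil Ng)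
      _ = (1 + x) ^ ⌈Ng⌉₊ := Real.rpow_natCast _ _
  have h2 := one_add_pow_mul_exp_neg_le (c := cπ) (c₀ := 1) (H := 1) (a' := 0) (τ := x) hcπ one_pos le_rfl le_rfl hx ⌈Ng⌉₊
  simp only [Real.one_rpow, mul_one, neg_zero, zero_mul] at h2
  have hE : 0 ≤ Real.exp (-(cπ * x)) := (Real.exp_pos _).le
  calc (1 + x) ^ Ng * Real.exp (-(cπ * x)) ≤ (1 + x) ^ ⌈Ng⌉₊ * Real.exp (-(cπ * x)) := mul_le_mul_of_nonneg_right h1 hE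
    _ = Real.exp (-(cπ * x)) * (1 + x) ^ ⌈Ng⌉₊ := mul_comm _ _
    _ ≤ _ := h2

/-- **THE PER-PLACE FACTOR OF THE BLOCK LETTER AT RATE `cπ`** (★ p864121 `perPlace_le` VERBATIM with the Gaussian rate `π ↦ cπ > 0`, payer-chosen — DESK WORD #13's repair
(R2) of the frozen-rate letter): `ρ^{e₁}·‖det Y‖^{e₂}·((1 + mρ)^{Ng}·e^{−cπ mρ}) ≤ a₁^{κ₁}·a₁^{κ₂}·(K(Ng,cπ)·e^{−(cπ∕2) mρ})`, two-sided `ρ` and `‖det Y‖` exactly as there.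
[cite: BorelJacquet1979, §1.2, §4.1] [cite: MoeglinWaldspurger1995, II.1.5, II.1.7] -/
theorem perPlace_le_rate {G Ginv A Ainv : Matrix (Fin 2) (Fin 2) ℂ} (hG : G * Ginv = 1) (hA : A * Ainv = 1)
    {Vb R a₁ : ℝ} (hVb : 1 ≤ Vb) (hGe : ∀ a b, ‖G a b‖ ≤ Vb) (hGie : ∀ a b, ‖Ginv a b‖ ≤ Vb)
    (hAe : ∀ a b, ‖A a b‖ ≤ R) (hAie : ∀ a b, ‖Ainv a b‖ ≤ R) {i : Fin 2} (hunit : ‖G 1 i‖ = 1)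
    (ha₁ : 8 * Vb ^ 2 * R ^ 2 ≤ a₁)
    {e₁ e₂ κ₁ κ₂ : ℝ} (he₁ : |e₁| ≤ κ₁) (he₂ : |e₂| ≤ κ₂) {cπ : ℝ} (hcπ : 0 < cπ) {m : ℝ} (hm : 0 ≤ m) (Ng : ℝ) :
    (∑ k, ‖(G * A) 1 k‖ ^ 2) ^ e₁ * ‖(G * A).det‖ ^ e₂ *
        ((1 + m * ∑ k, ‖(G * A) 1 k‖ ^ 2) ^ Ng * Real.exp (-(cπ * (m * ∑ k, ‖(G * A) 1 k‖ ^ 2)))) ≤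
      a₁ ^ κ₁ * a₁ ^ κ₂ * (((2 : ℝ) ^ ⌈Ng⌉₊ * (1 + ((⌈Ng⌉₊).factorial : ℝ) * (2 / cπ) ^ ⌈Ng⌉₊)) *
        Real.exp (-(cπ / 2 * (m * ∑ k, ‖(G * A) 1 k‖ ^ 2)))) := by
  have hR0 : 0 ≤ R := (norm_nonneg _).trans (hAe 0 0)
  have hVb0 : 0 ≤ Vb := zero_le_one.trans hVb
  have hρeq : ∑ k, ‖(G * A) 1 k‖ ^ 2 = ∑ k, ‖((fun l => G 1 l) ᵥ* A) k‖ ^ 2 := corner_row_sq_eq G A 1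
  have hunit' : 1 ≤ ‖(fun l => G 1 l) i‖ := by simp only [hunit, le_refl]
  have hρpos : 0 < ∑ k, ‖(G * A) 1 k‖ ^ 2 := by rw [hρeq]; exact sum_sq_vecMul_pos _ hA hAie hunit'
  have hρlo : (∑ k, ‖(G * A) 1 k‖ ^ 2)⁻¹ ≤ a₁ := by
    rw [hρeq]
    calc (∑ k, ‖((fun l => G 1 l) ᵥ* A) k‖ ^ 2)⁻¹ ≤ (2 : ℕ) * R ^ 2 := inv_sum_sq_vecMul_le _ hA hAie hunit'
      _ ≤ a₁ := by
          have hV1 : 1 ≤ Vb ^ 2 := one_le_pow₀ hVb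
          have h1 : R ^ 2 ≤ Vb ^ 2 * R ^ 2 := by nlinarith [sq_nonneg R]
          push_cast
          nlinarith [sq_nonneg R]
  have hYe : ∀ a b, ‖(G * A) a b‖ ≤ 2 * (Vb * R) := fun a b => by
    have := norm_mul_apply_le hVb0 hGe hAe a b
    simpa [Fintype.card_fin] using this
  have hρup : ∑ k, ‖(G * A) 1 k‖ ^ 2 ≤ a₁ := by
    calc ∑ k, ‖(G * A) 1 k‖ ^ 2 ≤ ∑ _k : Fin 2, (2 * (Vb * R)) ^ 2 :=
          Finset.sum_le_sum fun k _ => pow_le_pow_left₀ (norm_nonneg _) (hYe 1 k) 2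
      _ = 8 * Vb ^ 2 * R ^ 2 := by simp only [Finset.sum_const, Finset.card_univ, Fintype.card_fin, nsmul_eq_mul]; push_cast; ring
      _ ≤ a₁ := ha₁
  have hρ := rpow_le_rpow_of_abs_le hρpos hρup hρlo he₁
  have hYinv : (G * A) * (Ainv * Ginv) = 1 := by
    calc G * A * (Ainv * Ginv) = G * (A * Ainv) * Ginv := by simp only [Matrix.mul_assoc]
      _ = 1 := by rw [hA, Matrix.mul_one, hG]
  have hYie : ∀ a b, ‖(Ainv * Ginv) a b‖ ≤ 2 * (Vb * R) := fun a b => by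
    have := norm_mul_apply_le hR0 hAie hGie a b
    have h' : (Fintype.card (Fin 2) : ℝ) * (R * Vb) = 2 * (Vb * R) := by simp [Fintype.card_fin]; ring
    linarith
  have hdet0 := norm_det_rpow_le hYinv hYe hYie e₂
  have hdet : ‖(G * A).det‖ ^ e₂ ≤ a₁ ^ κ₂ := by
    have hb : ((Fintype.card (Fin 2)).factorial : ℝ) * (2 * (Vb * R)) ^ Fintype.card (Fin 2) = 8 * Vb ^ 2 * R ^ 2 := by
      simp [Fintype.card_fin]; ring
    rw [hb] at hdet0
    have ha₁1 : 1 ≤ a₁ := (one_le_of_le_of_inv_le hρpos hρup hρlo)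
    calc ‖(G * A).det‖ ^ e₂ ≤ (8 * Vb ^ 2 * R ^ 2) ^ |e₂| := hdet0
      _ ≤ a₁ ^ |e₂| := Real.rpow_le_rpow (by positivity) ha₁ (abs_nonneg _)
      _ ≤ a₁ ^ κ₂ := Real.rpow_le_rpow_of_exponent_le ha₁1 he₂
  have hmx : 0 ≤ m * ∑ k, ‖(G * A) 1 k‖ ^ 2 := mul_nonneg hm hρpos.le
  have hpoly := one_add_rpow_mul_exp_neg_le_rate hmx hcπ Ng
  have h0d : 0 ≤ ‖(G * A).det‖ ^ e₂ := Real.rpow_nonneg (norm_nonneg _) _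
  have h0p : 0 ≤ (1 + m * ∑ k, ‖(G * A) 1 k‖ ^ 2) ^ Ng * Real.exp (-(cπ * (m * ∑ k, ‖(G * A) 1 k‖ ^ 2))) :=
    mul_nonneg (Real.rpow_nonneg (by linarith) _) (Real.exp_pos _).le
  have ha₁0 : 0 ≤ a₁ := hρpos.le |> fun _ => le_trans (by positivity) ha₁
  exact mul_le_mul (mul_le_mul hρ hdet h0d (Real.rpow_nonneg ha₁0 _)) hpoly h0p
    (mul_nonneg (Real.rpow_nonneg ha₁0 _) (Real.rpow_nonneg ha₁0 _))

/-! ## §1 The one-frame assembly -/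

/-- **THE ONE-FRAME ASSEMBLY.**  Socket letters `(L, e, dV, dW)` with `dV, dW ≠ 0`; a section family `f` (by value); ONE `B`-line frame `F₀ = (eA₀ eB₀ dA₀ dB₀ hVA₀ hVB₀, Λ₀ hΛ₀, μ₀, nB₀)`
BY VALUE (★ `wdec_of_oneFrame`'s bytes); the NORMALISED row section `γ₀` with `hγ₀` and ★ p863259's normalisation clause `hnorm` BY VALUE; the archimedean frames of record BY VALUE
(`Sinf`, complex places `wp σ` fixed by complex conjugation and covering all infinite places, read through `(wp σ).1.embedding`; `er`, `T Tinv`, `M`); and the BLOCK LETTER `hBL₁` (module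
docstring).  THEN `∃ Nb, hdecF₀` — the (P-dec) head's letter VERBATIM (`Nb := 0`). [cite: MoeglinWaldspurger1995, II.1.5, II.1.7, IV.1.9] [cite: BorelJacquet1979, §1.2, §4.1]
[cite: KudlaRallis1994, §2 (2.10)–(2.12)] [cite: Shimura1997, §18.4 Prop. 18.14, §A3] -/
theorem hdecF₀_of_blockLetter_rate
    (L : Type) [Field L] [NumberField L] [IsCMField L] (e : Fin 2 × Fin 1 ≃ Fin 2)
    (dV : Fin 2 → L) (hdV : ∀ i, IsCMField.complexConj L (dV i) = dV i) (hdV0 : ∀ i, dV i ≠ 0)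
    (dW : Fin 1 → L) (hdW : ∀ i, IsCMField.complexConj L (dW i) = dW i) (hdW0 : ∀ i, dW i ≠ 0)
    (f : ℂ → HA L e dV hdV dW hdW → ℂ)
    -- ONE `B`-line frame `F₀` BY VALUE (★ `wdec_of_oneFrame`'s bytes)
    {n₁₀ n₂₀ : ℕ} (eA₀ : Fin 1 × Fin 1 ≃ Fin n₁₀) (eB₀ : Fin 1 × Fin 1 ≃ Fin n₂₀)
    (dA₀ : Fin 1 → L) (hdA₀ : ∀ i, IsCMField.complexConj L (dA₀ i) = dA₀ i)
    (dB₀ : Fin 1 → L) (hdB₀ : ∀ i, IsCMField.complexConj L (dB₀ i) = dB₀ i)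
    (hVA₀ : ∀ i, dV (Fin.castAdd 1 i) = dA₀ i) (hVB₀ : ∀ j, dV (Fin.natAdd 1 j) = dB₀ j)
    [MeasurableSpace (unipDelta L eB₀ dB₀ hdB₀ dW hdW)]
    (Λ₀ : GL (Fin 2) (AdeleRing (𝓞 L) L) →* HA L e dV hdV dW hdW)
    (hΛ₀ : ∀ g : GL (Fin 2) (AdeleRing (𝓞 L) L), blk L e dV hdV dW hdW (Λ₀ g) =
      cayR (AdeleRing (𝓞 L) L) (Fin 2) * Matrix.fromBlocks (g : Matrix (Fin 2) (Fin 2) (AdeleRing (𝓞 L) L)) 0 0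
        (((gramR L e dV hdV dW hdW).map ((algebraMap L (AdeleRing (𝓞 L) L)).comp (algebraMap (Fp L) L)))⁻¹ *
          (((g⁻¹ : GL (Fin 2) (AdeleRing (𝓞 L) L)) : Matrix (Fin 2) (Fin 2) (AdeleRing (𝓞 L) L)).map
            (conjAdele (Fp L) L (IsCMField.complexConj L)))ᵀ *
          (gramR L e dV hdV dW hdW).map ((algebraMap L (AdeleRing (𝓞 L) L)).comp (algebraMap (Fp L) L))) *
        cayRinv (AdeleRing (𝓞 L) L) (Fin 2))
    [MeasurableSpace (AdeleRing (𝓞 (Fp L)) (Fp L))]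
    (μ₀ : Measure (AdeleRing (𝓞 (Fp L)) (Fp L)))
    (nB₀ : AdeleRing (𝓞 (Fp L)) (Fp L) → unipDelta L eB₀ dB₀ hdB₀ dW hdW)
    -- the NORMALISED row section BY VALUE (★ p863259 `exists_normalised_rowSection`'s clauses)
    (γ₀ : Projectivization L (Fin 2 → L) → GL (Fin 2) L)
    (hγ₀ : ∀ p, Projectivization.mk L ((γ₀ p : Matrix (Fin 2) (Fin 2) L) 1) (row_ne_zero (γ₀ p) 1) = p)
    (hnorm : ∀ (w : Fin 2 → L) (hw : w ≠ 0), ∃ i : Fin 2, w i ≠ 0 ∧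
      (γ₀ (Projectivization.mk L w hw) : Matrix (Fin 2) (Fin 2) L) 1 = (w i)⁻¹ • w ∧
      ∀ a b : Fin 2,
        (∃ k : Fin 2, (γ₀ (Projectivization.mk L w hw) : Matrix (Fin 2) (Fin 2) L) a b = 0 ∨
          (γ₀ (Projectivization.mk L w hw) : Matrix (Fin 2) (Fin 2) L) a b = 1 ∨
          (γ₀ (Projectivization.mk L w hw) : Matrix (Fin 2) (Fin 2) L) a b = (w i)⁻¹ * w k ∨
          (γ₀ (Projectivization.mk L w hw) : Matrix (Fin 2) (Fin 2) L) a b = -((w i)⁻¹ * w k)) ∧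
        (∃ k : Fin 2, (((γ₀ (Projectivization.mk L w hw))⁻¹ : GL (Fin 2) L) : Matrix (Fin 2) (Fin 2) L) a b = 0 ∨
          (((γ₀ (Projectivization.mk L w hw))⁻¹ : GL (Fin 2) L) : Matrix (Fin 2) (Fin 2) L) a b = 1 ∨
          (((γ₀ (Projectivization.mk L w hw))⁻¹ : GL (Fin 2) L) : Matrix (Fin 2) (Fin 2) L) a b = (w i)⁻¹ * w k ∨
          (((γ₀ (Projectivization.mk L w hw))⁻¹ : GL (Fin 2) L) : Matrix (Fin 2) (Fin 2) L) a b = -((w i)⁻¹ * w k)))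
    -- the archimedean frames of record BY VALUE (★ G7 ∕ ★ `K2LiuSiegelEisensteinKindWArchAdapter`)
    (hc : (IsCMField.complexConj L : L ≃ₐ[Fp L] L) ≠ 1)
    {Sinf : Type} [Fintype Sinf] (wp : Sinf → {v : InfinitePlace L // IsComplex v})
    (hwp : ∀ σ, (IsCMField.complexConj L : L ≃ₐ[Fp L] L) • (wp σ).1 = (wp σ).1)
    (hcover : ∀ v : InfinitePlace L, ∃ σ, (wp σ).1 = v)
    (er : Fin 2 ⊕ Fin 2 ≃ Fin (2 + 2)) (T Tinv : Sinf → Matrix (Fin 2 ⊕ Fin 2) (Fin 2 ⊕ Fin 2) ℂ) (hT : ∀ σ, T σ * Tinv σ = 1) (hT' : ∀ σ, Tinv σ * T σ = 1)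
    {M : ℝ} (hM : 1 ≤ M) (hTe : ∀ σ i j, ‖T σ i j‖ ≤ M) (hTe' : ∀ σ i j, ‖Tinv σ i j‖ ≤ M)
    -- THE BLOCK LETTER (the (dec-2) fine letter in block currency ON `h`)
    (hBL₁ : ∀ z : ℂ, 0 < z.re → ∃ (C a a₂ κ₁ κ₂ Ng r cπ : ℝ) (N₀ : ℕ) (e₁ e₂ : ℂ → ℝ),
      0 ≤ C ∧ 0 ≤ a ∧ 0 ≤ a₂ ∧ 0 ≤ Ng ∧ 0 < r ∧ 0 < cπ ∧ (∀ s : ℂ, dist s z < r → |e₁ s| ≤ κ₁ ∧ |e₂ s| ≤ κ₂) ∧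
      ∀ (S : skewMatrices ((IsCMField.complexConj L : L ≃ₐ[Fp L] L) : L →+* L) ((gramR L e dV hdV dW hdW).map (algebraMap (Fp L) L))) (u w : Fin 2 → L),
        (S : Matrix (Fin 2) (Fin 2) L) = Matrix.vecMulVec u w → u ≠ 0 → ∀ (hw : w ≠ 0) (S' : Matrix (Fin 2) (Fin 2) L),
        (∀ v : HA L e dV hdV dW hdW, v ∈ unipDelta L e dV hdV dW hdW →
          unipDeltaChar L e dV hdV dW hdW (S : Matrix (Fin 2) (Fin 2) L) ((Λ₀ (Matrix.GeneralLinearGroup.map (algebraMap L (AdeleRing (𝓞 L) L)) (γ₀ (Projectivization.mk L w hw))))⁻¹ * v * Λ₀ (Matrix.GeneralLinearGroup.map (algebraMap L (AdeleRing (𝓞 L) L)) (γ₀ (Projectivization.mk L w hw)))) =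
            unipDeltaChar L e dV hdV dW hdW S' v) →
        ∀ D : ℕ, 1 ≤ D → (∀ i j, IsIntegral ℤ ((D : L) * (S : Matrix (Fin 2) (Fin 2) L) i j)) →
        ∀ (D₀ : Matrix (Fin 2) (Fin 2) L) (σf : L),
        (((γ₀ (Projectivization.mk L w hw) : GL (Fin 2) L) : Matrix (Fin 2) (Fin 2) L).map ((IsCMField.complexConj L : L ≃ₐ[Fp L] L) : L →+* L))ᵀ * (gramR L e dV hdV dW hdW).map (algebraMap (Fp L) L) * D₀ =
            (gramR L e dV hdV dW hdW).map (algebraMap (Fp L) L) →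
        D₀ * (S : Matrix (Fin 2) (Fin 2) L) * ((γ₀ (Projectivization.mk L w hw) : GL (Fin 2) L) : Matrix (Fin 2) (Fin 2) L)⁻¹ = Matrix.single 1 1 σf →
        ∀ s : ℂ, dist s z < r → ∀ (h : HA L e dV hdV dW hdW) (A b d : Sinf → Matrix (Fin 2) (Fin 2) ℂ) (κ κ' : Sinf → Matrix (Fin 2 ⊕ Fin 2) (Fin 2 ⊕ Fin 2) ℂ),
        (∀ σ, κ σ * κ' σ = 1) → (∀ σ, κ' σ * κ σ = 1) → (∀ σ i j, ‖κ σ i j‖ ≤ M) → (∀ σ i j, ‖κ' σ i j‖ ≤ M) →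
        (∀ σ, T σ * Matrix.reindex er.symm er.symm
            ((((archAt (Fp L) L (IsCMField.complexConj L : L ≃ₐ[Fp L] L) (2 + 2) (hermD L e dV hdV dW hdW) (wp σ) (hwp σ) hc
                (archPart (Fp L) L (IsCMField.complexConj L : L ≃ₐ[Fp L] L) (2 + 2) (hermD L e dV hdV dW hdW) h) :
                archLocal L (2 + 2) (hermD L e dV hdV dW hdW) (wp σ)) : GL (Fin (2 + 2)) ℂ) : Matrix (Fin (2 + 2)) (Fin (2 + 2)) ℂ)) * Tinv σ =
          Matrix.fromBlocks (A σ) (b σ) 0 (d σ) * κ σ) →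
        ‖whittakerDelta L eB₀ dB₀ hdB₀ dW hdW (Measure.map nB₀ μ₀)
            ((Matrix.reindex (idxSplit e eA₀ eB₀) (idxSplit e eA₀ eB₀) S').toBlocks₂₂)
            (fun y => f s (blkD L e eA₀ eB₀ dA₀ hdA₀ dB₀ hdB₀ dV hdV hVA₀ hVB₀ dW hdW (1, y) * (Λ₀ (Matrix.GeneralLinearGroup.map (algebraMap L (AdeleRing (𝓞 L) L)) (γ₀ (Projectivization.mk L w hw))) * h))) 1‖ ≤
          C * adelicHeightGL (2 + 2) L (h : GL (Fin (2 + 2)) (AdeleRing (𝓞 L) L)) ^ a * (D : ℝ) ^ a₂ *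
            (1 + ‖(fun i j => NumberField.mixedEmbedding L ((S : Matrix (Fin 2) (Fin 2) L) i j))‖) ^ N₀ *
            ∏ σ, ((∑ k, ‖(((γ₀ (Projectivization.mk L w hw) : GL (Fin 2) L) : Matrix (Fin 2) (Fin 2) L).map (wp σ).1.embedding * A σ) 1 k‖ ^ 2) ^ e₁ s * ‖(((γ₀ (Projectivization.mk L w hw) : GL (Fin 2) L) : Matrix (Fin 2) (Fin 2) L).map (wp σ).1.embedding * A σ).det‖ ^ e₂ s *
              ((1 + (wp σ).1 σf * (∑ k, ‖(((γ₀ (Projectivization.mk L w hw) : GL (Fin 2) L) : Matrix (Fin 2) (Fin 2) L).map (wp σ).1.embedding * A σ) 1 k‖ ^ 2)) ^ Ng * Real.exp (-(cπ * ((wp σ).1 σf * (∑ k, ‖(((γ₀ (Projectivization.mk L w hw) : GL (Fin 2) L) : Matrix (Fin 2) (Fin 2) L).map (wp σ).1.embedding * A σ) 1 k‖ ^ 2))))))) :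
    ∃ Nb : ℕ,
      ∀ z : ℂ, 0 < z.re → ∃ C a a₂ c a' r : ℝ, 0 ≤ C ∧ 0 ≤ a ∧ 0 ≤ a₂ ∧ 0 < c ∧ 0 ≤ a' ∧ 0 < r ∧
        ∀ (S : skewMatrices ((IsCMField.complexConj L : L ≃ₐ[Fp L] L) : L →+* L) ((gramR L e dV hdV dW hdW).map (algebraMap (Fp L) L))) (u w : Fin 2 → L),
          (S : Matrix (Fin 2) (Fin 2) L) = Matrix.vecMulVec u w → u ≠ 0 → ∀ (hw : w ≠ 0) (S' : Matrix (Fin 2) (Fin 2) L),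
          (∀ v : HA L e dV hdV dW hdW, v ∈ unipDelta L e dV hdV dW hdW →
            unipDeltaChar L e dV hdV dW hdW (S : Matrix (Fin 2) (Fin 2) L) ((Λ₀ (Matrix.GeneralLinearGroup.map (algebraMap L (AdeleRing (𝓞 L) L)) (γ₀ (Projectivization.mk L w hw))))⁻¹ * v * Λ₀ (Matrix.GeneralLinearGroup.map (algebraMap L (AdeleRing (𝓞 L) L)) (γ₀ (Projectivization.mk L w hw)))) =
              unipDeltaChar L e dV hdV dW hdW S' v) →
          ∀ D : ℕ, 1 ≤ D → (∀ i j, IsIntegral ℤ ((D : L) * (S : Matrix (Fin 2) (Fin 2) L) i j)) →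
          ∀ s : ℂ, dist s z < r → ∀ h : HA L e dV hdV dW hdW,
            ‖whittakerDelta L eB₀ dB₀ hdB₀ dW hdW (Measure.map nB₀ μ₀)
                ((Matrix.reindex (idxSplit e eA₀ eB₀) (idxSplit e eA₀ eB₀) S').toBlocks₂₂)
                (fun y => f s (blkD L e eA₀ eB₀ dA₀ hdA₀ dB₀ hdB₀ dV hdV hVA₀ hVB₀ dW hdW (1, y) * (Λ₀ (Matrix.GeneralLinearGroup.map (algebraMap L (AdeleRing (𝓞 L) L)) (γ₀ (Projectivization.mk L w hw))) * h))) 1‖ ≤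
              C * adelicHeightGL (2 + 2) L (h : GL (Fin (2 + 2)) (AdeleRing (𝓞 L) L)) ^ a * (D : ℝ) ^ a₂ *
                (Real.exp (-(c * adelicHeightGL (2 + 2) L (h : GL (Fin (2 + 2)) (AdeleRing (𝓞 L) L)) ^ (-a') * ‖(fun i j => NumberField.mixedEmbedding L ((S : Matrix (Fin 2) (Fin 2) L) i j))‖)) * (1 + ‖(fun i j => NumberField.mixedEmbedding L ((S : Matrix (Fin 2) (Fin 2) L) i j))‖) ^ Nb) := by
  classical
  letI : MeasurableSpace (unipDelta L e dV hdV dW hdW) := borel _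
  haveI : BorelSpace (unipDelta L e dV hdV dW hdW) := ⟨rfl⟩
  obtain ⟨c₀, hc₀, hfloor⟩ := exists_adelicHeightGL_floor L (2 + 2)
  have hM0 : 0 ≤ M := zero_le_one.trans hM
  obtain ⟨cB', hcB'⟩ : ∃ cB' : ℝ, cB' = (Fintype.card (Fin 2 ⊕ Fin 2) : ℝ) ^ 3 * M ^ 3 + c₀⁻¹ := ⟨_, rfl⟩
  have hcBle : (Fintype.card (Fin 2 ⊕ Fin 2) : ℝ) ^ 3 * M ^ 3 ≤ cB' := by
    rw [hcB']; exact le_add_of_nonneg_right (inv_nonneg.2 hc₀.le)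
  have hcB'inv : c₀⁻¹ ≤ cB' := by
    rw [hcB']; exact le_add_of_nonneg_left (by positivity)
  have hcB'pos : 0 < cB' := lt_of_lt_of_le (inv_pos.2 hc₀) hcB'inv
  refine ⟨0, fun z hz => ?_⟩
  obtain ⟨C, a, a₂, κ₁, κ₂, Ng, r, cπ, N₀, e₁, e₂, hC, ha, ha₂, hNg, hr, hcπ, hexp, hB⟩ := hBL₁ z hz
  obtain ⟨cg, hcg, hgauss⟩ := K2LiuKindOneLineCornerGramBoundAdelic.exists_exp_neg_sum_le_exp_neg_height_of_cover_rate L e dV hdV dW hdW hdV0 hdW0 (1 : Fin 2)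
    hcB'pos (half_pos hcπ)
  obtain ⟨k, hk⟩ : ∃ k : ℕ, k = ⌈κ₁⌉₊ + ⌈κ₂⌉₊ := ⟨_, rfl⟩
  obtain ⟨nS, hnS⟩ : ∃ nS : ℕ, nS = Fintype.card Sinf := ⟨_, rfl⟩
  obtain ⟨dL, hdL⟩ : ∃ dL : ℕ, dL = Module.finrank ℚ L := ⟨_, rfl⟩
  obtain ⟨Mτ, hMτ⟩ : ∃ Mτ : ℕ, Mτ = N₀ + 2 * (dL + 1) * k * nS := ⟨_, rfl⟩
  obtain ⟨K, hK⟩ : ∃ K : ℝ, K = (2 : ℝ) ^ ⌈Ng⌉₊ * (1 + ((⌈Ng⌉₊).factorial : ℝ) * (2 / cπ) ^ ⌈Ng⌉₊) := ⟨_, rfl⟩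
  have hK0 : 0 ≤ K := by rw [hK]; positivity
  obtain ⟨P0, hP0⟩ : ∃ P0 : ℝ, P0 = 8 * cB' ^ 2 := ⟨_, rfl⟩
  have hP00 : 0 ≤ P0 := by rw [hP0]; positivity
  obtain ⟨Kabs, hKabs⟩ : ∃ Kabs : ℝ,
      Kabs = (2 : ℝ) ^ Mτ * (c₀ ^ (-((2 : ℝ) * Mτ)) + (Mτ.factorial : ℝ) * (2 / (cg / 2)) ^ Mτ) := ⟨_, rfl⟩
  have hKabs0 : 0 ≤ Kabs := by
    rw [hKabs]
    exact mul_nonneg (pow_nonneg zero_le_two _) (add_nonneg (Real.rpow_nonneg hc₀.le _) (by positivity))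
  refine ⟨C * (P0 ^ k * K) ^ nS * Kabs, a + ((2 * k * nS : ℕ) : ℝ) + 2 * (Mτ : ℝ), a₂ + ((2 * (dL + 1) * k * nS : ℕ) : ℝ), cg / 2 / 2, 2, r,
    mul_nonneg (mul_nonneg hC (pow_nonneg (mul_nonneg (pow_nonneg hP00 _) hK0) _)) hKabs0, by positivity, by positivity, by positivity,
    by norm_num, hr, fun S u w_ hS1 hu hw S' hψ D hD hint s hs h => ?_⟩
  obtain ⟨Hh, hHh⟩ : ∃ Hh : ℝ, adelicHeightGL (2 + 2) L (h : GL (Fin (2 + 2)) (AdeleRing (𝓞 L) L)) = Hh := ⟨_, rfl⟩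
  obtain ⟨τ, hτ⟩ : ∃ τ : ℝ, ‖(fun i j => NumberField.mixedEmbedding L ((S : Matrix (Fin 2) (Fin 2) L) i j))‖ = τ := ⟨_, rfl⟩
  rw [hHh, hτ]
  have hH : c₀ ≤ Hh := hHh ▸ hfloor _
  have hH0 : 0 < Hh := lt_of_lt_of_le hc₀ hH
  have hτ0 : 0 ≤ τ := hτ ▸ norm_nonneg _
  have hD1 : (1 : ℝ) ≤ D := by exact_mod_cast hD
  have hD0 : (0 : ℝ) < D := by linarith
  have hM1 : 1 ≤ cB' * Hh := by
    calc (1 : ℝ) = c₀⁻¹ * c₀ := (inv_mul_cancel₀ hc₀.ne').symm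
      _ ≤ cB' * Hh := mul_le_mul hcB'inv hH hc₀.le hcB'pos.le
  have hκ : |e₁ s| ≤ (⌈κ₁⌉₊ : ℝ) ∧ |e₂ s| ≤ (⌈κ₂⌉₊ : ℝ) :=
    ⟨((hexp s hs).1).trans (Nat.le_ceil _), ((hexp s hs).2).trans (Nat.le_ceil _)⟩
  have hlevi := exists_rat_levi_blocks_levi_map Λ₀ hΛ₀ hdV0 hdW0 (γ₀ (Projectivization.mk L w_ hw))
  obtain ⟨-, D₀, hd, hrel, hD₀⟩ := hlevi
  have hci := conj_index_eq_single Λ₀ hΛ₀ hdV0 hdW0 S.2 hS1 hu hw γ₀ hγ₀ hd hD₀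
  obtain ⟨hsingle, -⟩ := hci
  obtain ⟨σf, hσf⟩ : ∃ σf : L, (D₀ * (S : Matrix (Fin 2) (Fin 2) L) *
      ((γ₀ (Projectivization.mk L w_ hw) : GL (Fin 2) L) : Matrix (Fin 2) (Fin 2) L)⁻¹) 1 1 = σf := ⟨_, rfl⟩
  rw [hσf] at hsingle
  have hbd := exists_blockDecomposition_archAt (Fp L) L (IsCMField.complexConj L : L ≃ₐ[Fp L] L) (2 + 2) (hermD L e dV hdV dW hdW)
    hc wp hwp er T Tinv hT hM h
  obtain ⟨A, bb, dd, κm, κm', hκm, hκm', hκme, hκme', hdec⟩ := hbd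
  have hblk : ∀ σ, (∀ i j, ‖A σ i j‖ ≤ cB' * Hh) ∧ (∀ i j, ‖(A σ)⁻¹ i j‖ ≤ cB' * Hh) ∧ A σ * (A σ)⁻¹ = 1 := by
    intro σ
    have hb := blockData_of_decomp (Fp L) L (IsCMField.complexConj L : L ≃ₐ[Fp L] L) (2 + 2) (hermD L e dV hdV dW hdW) hc wp hwp er T Tinv hT hT'
      hM hTe hTe' h A bb dd κm κm' hκm hκm' hκme hκme' hdec σ
    rw [adelicVal_apply, hHh] at hb
    have hle : (Fintype.card (Fin 2 ⊕ Fin 2) : ℝ) ^ 3 * M ^ 3 * Hh ≤ cB' * Hh := mul_le_mul_of_nonneg_right hcBle hH0.le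
    exact ⟨fun i j => (hb.1 i j).trans hle, fun i j => (hb.2.1 i j).trans hle, hb.2.2⟩
  have hmain := hB S u w_ hS1 hu hw S' hψ D hD hint D₀ σf hrel hsingle s hs h A bb dd κm κm' hκm hκm' hκme hκme' hdec
  rw [hHh, hτ] at hmain
  obtain ⟨i, hwi, hrow, hent⟩ := hnorm w_ hw
  obtain ⟨j, huj⟩ : ∃ j, u j ≠ 0 := Function.ne_iff.1 hu
  obtain ⟨B, hBdef⟩ : ∃ B : ℝ, B = τ * ((D : ℝ) ^ (dL + 1) * (1 + τ) ^ dL) := ⟨_, rfl⟩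
  have hB0 : 0 ≤ B := by rw [hBdef]; positivity
  have hratio : ∀ (σ : Sinf) (k' : Fin 2), ‖(wp σ).1.embedding ((w_ i)⁻¹ * w_ k')‖ ≤ B := fun σ k' => by
    have h1 := norm_embedding_ratio_le (wp σ).1 hS1 huj hwi hD hint k'
    rwa [hτ, ← hdL, ← hBdef] at h1
  have hGe : ∀ (σ : Sinf) (a' b' : Fin 2),
      ‖(((γ₀ (Projectivization.mk L w_ hw) : GL (Fin 2) L) : Matrix (Fin 2) (Fin 2) L).map (wp σ).1.embedding) a' b'‖ ≤ 1 + B :=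
    fun σ a' b' => by
      rw [Matrix.map_apply]
      obtain ⟨⟨k', hk'⟩, -⟩ := hent a' b'
      exact norm_embedding_le_one_add_of_cases (wp σ).1 hB0 (hratio σ k') hk'
  have hGie : ∀ (σ : Sinf) (a' b' : Fin 2),
      ‖((((γ₀ (Projectivization.mk L w_ hw))⁻¹ : GL (Fin 2) L) : Matrix (Fin 2) (Fin 2) L).map (wp σ).1.embedding) a' b'‖ ≤ 1 + B :=
    fun σ a' b' => by
      rw [Matrix.map_apply]
      obtain ⟨-, ⟨k', hk'⟩⟩ := hent a' b'
      exact norm_embedding_le_one_add_of_cases (wp σ).1 hB0 (hratio σ k') hk'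
  have hGG : ∀ σ : Sinf, ((γ₀ (Projectivization.mk L w_ hw) : GL (Fin 2) L) : Matrix (Fin 2) (Fin 2) L).map (wp σ).1.embedding *
      (((γ₀ (Projectivization.mk L w_ hw))⁻¹ : GL (Fin 2) L) : Matrix (Fin 2) (Fin 2) L).map (wp σ).1.embedding = 1 := fun σ => by
    rw [← Matrix.map_mul, Units.mul_inv, Matrix.map_one _ (map_zero _) (map_one _)]
  have hunit : ∀ σ : Sinf, ‖(((γ₀ (Projectivization.mk L w_ hw) : GL (Fin 2) L) : Matrix (Fin 2) (Fin 2) L).map (wp σ).1.embedding) 1 i‖ = 1 :=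
    fun σ => by
      rw [Matrix.map_apply]
      exact norm_map_row_apply_eq_one (wp σ).1.embedding hwi hrow
  have hVb1 : 1 ≤ 1 + B := le_add_of_nonneg_right hB0
  obtain ⟨V, hV⟩ : ∃ V : ℝ, V = Hh ^ 2 * ((D : ℝ) ^ (dL + 1) * (1 + τ) ^ (dL + 1)) ^ 2 := ⟨_, rfl⟩
  have hV0 : 0 ≤ V := by rw [hV]; positivity
  have ha₁ : 8 * (1 + B) ^ 2 * (cB' * Hh) ^ 2 ≤ P0 * V := by
    have hW0 : 1 + B ≤ (D : ℝ) ^ (dL + 1) * (1 + τ) ^ (dL + 1) := by rw [hBdef]; exact one_add_mul_le_pow_mul_pow hD1 hτ0 dL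
    have hB1 : 0 ≤ 1 + B := by linarith
    calc 8 * (1 + B) ^ 2 * (cB' * Hh) ^ 2 ≤ 8 * ((D : ℝ) ^ (dL + 1) * (1 + τ) ^ (dL + 1)) ^ 2 * (cB' * Hh) ^ 2 := by gcongr
      _ = P0 * V := by rw [hP0, hV]; ring
  have hρ0 : ∀ σ : Sinf, 0 ≤ ∑ k', ‖(((γ₀ (Projectivization.mk L w_ hw) : GL (Fin 2) L) : Matrix (Fin 2) (Fin 2) L).map (wp σ).1.embedding * A σ) 1 k'‖ ^ 2 :=
    fun σ => Finset.sum_nonneg fun _ _ => sq_nonneg _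
  have hper : ∀ σ : Sinf,
      (∑ k', ‖(((γ₀ (Projectivization.mk L w_ hw) : GL (Fin 2) L) : Matrix (Fin 2) (Fin 2) L).map (wp σ).1.embedding * A σ) 1 k'‖ ^ 2) ^ e₁ s *
          ‖(((γ₀ (Projectivization.mk L w_ hw) : GL (Fin 2) L) : Matrix (Fin 2) (Fin 2) L).map (wp σ).1.embedding * A σ).det‖ ^ e₂ s *
        ((1 + (wp σ).1 σf * (∑ k', ‖(((γ₀ (Projectivization.mk L w_ hw) : GL (Fin 2) L) : Matrix (Fin 2) (Fin 2) L).map (wp σ).1.embedding * A σ) 1 k'‖ ^ 2)) ^ Ng *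
          Real.exp (-(cπ * ((wp σ).1 σf * (∑ k', ‖(((γ₀ (Projectivization.mk L w_ hw) : GL (Fin 2) L) : Matrix (Fin 2) (Fin 2) L).map (wp σ).1.embedding * A σ) 1 k'‖ ^ 2))))) ≤
      (P0 ^ k * V ^ k * K) *
        Real.exp (-(cπ / 2 * ((wp σ).1 σf * (∑ k', ‖(((γ₀ (Projectivization.mk L w_ hw) : GL (Fin 2) L) : Matrix (Fin 2) (Fin 2) L).map (wp σ).1.embedding * A σ) 1 k'‖ ^ 2)))) := by
    intro σ
    have hp := perPlace_le_rate (hGG σ) (hblk σ).2.2 hVb1 (hGe σ) (hGie σ) (hblk σ).1 (hblk σ).2.1 (hunit σ)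
      ha₁ hκ.1 hκ.2 hcπ (apply_nonneg (wp σ).1 σf) Ng
    refine hp.trans (le_of_eq ?_)
    have hQ1 : (P0 * V) ^ ((⌈κ₁⌉₊ : ℕ) : ℝ) * (P0 * V) ^ ((⌈κ₂⌉₊ : ℕ) : ℝ) = P0 ^ k * V ^ k := by
      rw [Real.rpow_natCast, Real.rpow_natCast, ← pow_add, ← hk, mul_pow]
    rw [hQ1, ← hK]
    ring
  have hF0 : ∀ σ : Sinf, 0 ≤
      (∑ k', ‖(((γ₀ (Projectivization.mk L w_ hw) : GL (Fin 2) L) : Matrix (Fin 2) (Fin 2) L).map (wp σ).1.embedding * A σ) 1 k'‖ ^ 2) ^ e₁ s *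
          ‖(((γ₀ (Projectivization.mk L w_ hw) : GL (Fin 2) L) : Matrix (Fin 2) (Fin 2) L).map (wp σ).1.embedding * A σ).det‖ ^ e₂ s *
        ((1 + (wp σ).1 σf * (∑ k', ‖(((γ₀ (Projectivization.mk L w_ hw) : GL (Fin 2) L) : Matrix (Fin 2) (Fin 2) L).map (wp σ).1.embedding * A σ) 1 k'‖ ^ 2)) ^ Ng *
          Real.exp (-(cπ * ((wp σ).1 σf * (∑ k', ‖(((γ₀ (Projectivization.mk L w_ hw) : GL (Fin 2) L) : Matrix (Fin 2) (Fin 2) L).map (wp σ).1.embedding * A σ) 1 k'‖ ^ 2))))) :=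
    fun σ => mul_nonneg (mul_nonneg (Real.rpow_nonneg (hρ0 σ) _) (Real.rpow_nonneg (norm_nonneg _) _))
      (mul_nonneg (Real.rpow_nonneg (add_nonneg zero_le_one (mul_nonneg (apply_nonneg _ _) (hρ0 σ))) _) (Real.exp_pos _).le)
  have hprod := Finset.prod_le_prod (fun σ _ => hF0 σ) (fun σ _ => hper σ) (s := Finset.univ)
  have hprod2 : ∏ σ : Sinf, (P0 ^ k * V ^ k * K) *
        Real.exp (-(cπ / 2 * ((wp σ).1 σf * (∑ k', ‖(((γ₀ (Projectivization.mk L w_ hw) : GL (Fin 2) L) : Matrix (Fin 2) (Fin 2) L).map (wp σ).1.embedding * A σ) 1 k'‖ ^ 2)))) =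
      (P0 ^ k * V ^ k * K) ^ nS * Real.exp (-(cπ / 2 * ∑ σ : Sinf, (wp σ).1 σf *
        (∑ k', ‖(((γ₀ (Projectivization.mk L w_ hw) : GL (Fin 2) L) : Matrix (Fin 2) (Fin 2) L).map (wp σ).1.embedding * A σ) 1 k'‖ ^ 2))) := by
    rw [Finset.prod_mul_distrib, Finset.prod_const, Finset.card_univ, ← hnS, ← Real.exp_sum, Finset.mul_sum, ← Finset.sum_neg_distrib]
  have hga := hgauss (fun σ : Sinf => (wp σ).1) hcover (γ₀ (Projectivization.mk L w_ hw)) D₀ hrel (S : Matrix (Fin 2) (Fin 2) L) σf hsingle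
    A (fun σ => (A σ)⁻¹) (fun σ => (hblk σ).2.2) (M := cB' * Hh) (fun σ k' l => (hblk σ).2.1 k' l)
    (fun σ => Real.sqrt (∑ k', ‖(((γ₀ (Projectivization.mk L w_ hw) : GL (Fin 2) L) : Matrix (Fin 2) (Fin 2) L).map (wp σ).1.embedding * A σ) 1 k'‖ ^ 2))
    (fun σ => by
      rw [Real.sq_sqrt (hρ0 σ), K2LiuKindOneLineCornerBlockFaces.corner_row_sq_eq]
      rfl)
    hH0 hM1 le_rfl
  have hsum_eq : ∑ σ : Sinf, (wp σ).1 σf *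
        Real.sqrt (∑ k', ‖(((γ₀ (Projectivization.mk L w_ hw) : GL (Fin 2) L) : Matrix (Fin 2) (Fin 2) L).map (wp σ).1.embedding * A σ) 1 k'‖ ^ 2) ^ 2 =
      ∑ σ : Sinf, (wp σ).1 σf * (∑ k', ‖(((γ₀ (Projectivization.mk L w_ hw) : GL (Fin 2) L) : Matrix (Fin 2) (Fin 2) L).map (wp σ).1.embedding * A σ) 1 k'‖ ^ 2) :=
    Finset.sum_congr rfl fun σ _ => by rw [Real.sq_sqrt (hρ0 σ)]
  rw [hsum_eq, hτ] at hga
  have hexp2 : Real.exp (-(cπ / 2 * ∑ σ : Sinf, (wp σ).1 σf *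
        (∑ k', ‖(((γ₀ (Projectivization.mk L w_ hw) : GL (Fin 2) L) : Matrix (Fin 2) (Fin 2) L).map (wp σ).1.embedding * A σ) 1 k'‖ ^ 2))) ≤
      Real.exp (-(cg / 2 * Hh ^ (-(2 : ℝ)) * τ)) := by
    have h1 := Real.exp_le_exp.1 hga
    have hX : 0 ≤ cg * Hh ^ (-(2 : ℝ)) * τ := by positivity
    exact Real.exp_le_exp.2 (by linarith)
  have habs := one_add_pow_mul_exp_neg_le (c := cg / 2) (c₀ := c₀) (H := Hh) (a' := 2) (τ := τ) (half_pos hcg) hc₀ hH (by norm_num) hτ0 Mτ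
  rw [← hKabs] at habs
  have hE0 : 0 ≤ Real.exp (-(cg / 2 * Hh ^ (-(2 : ℝ)) * τ)) := (Real.exp_pos _).le
  calc ‖whittakerDelta L eB₀ dB₀ hdB₀ dW hdW (Measure.map nB₀ μ₀)
            ((Matrix.reindex (idxSplit e eA₀ eB₀) (idxSplit e eA₀ eB₀) S').toBlocks₂₂)
            (fun y => f s (blkD L e eA₀ eB₀ dA₀ hdA₀ dB₀ hdB₀ dV hdV hVA₀ hVB₀ dW hdW (1, y) *
              (Λ₀ (Matrix.GeneralLinearGroup.map (algebraMap L (AdeleRing (𝓞 L) L)) (γ₀ (Projectivization.mk L w_ hw))) * h))) 1‖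
      ≤ C * Hh ^ a * (D : ℝ) ^ a₂ * (1 + τ) ^ N₀ *
          ∏ σ : Sinf, (∑ k', ‖(((γ₀ (Projectivization.mk L w_ hw) : GL (Fin 2) L) : Matrix (Fin 2) (Fin 2) L).map (wp σ).1.embedding * A σ) 1 k'‖ ^ 2) ^ e₁ s *
              ‖(((γ₀ (Projectivization.mk L w_ hw) : GL (Fin 2) L) : Matrix (Fin 2) (Fin 2) L).map (wp σ).1.embedding * A σ).det‖ ^ e₂ s *
            ((1 + (wp σ).1 σf * (∑ k', ‖(((γ₀ (Projectivization.mk L w_ hw) : GL (Fin 2) L) : Matrix (Fin 2) (Fin 2) L).map (wp σ).1.embedding * A σ) 1 k'‖ ^ 2)) ^ Ng *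
              Real.exp (-(cπ * ((wp σ).1 σf * (∑ k', ‖(((γ₀ (Projectivization.mk L w_ hw) : GL (Fin 2) L) : Matrix (Fin 2) (Fin 2) L).map (wp σ).1.embedding * A σ) 1 k'‖ ^ 2))))) := hmain
    _ ≤ C * Hh ^ a * (D : ℝ) ^ a₂ * (1 + τ) ^ N₀ * ((P0 ^ k * V ^ k * K) ^ nS * Real.exp (-(cg / 2 * Hh ^ (-(2 : ℝ)) * τ))) := by
        refine mul_le_mul_of_nonneg_left (hprod.trans ?_) (by positivity)
        rw [hprod2]
        exact mul_le_mul_of_nonneg_left hexp2 (by positivity)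
    _ = C * (P0 ^ k * K) ^ nS * (Hh ^ a * Hh ^ (2 * k * nS)) * ((D : ℝ) ^ a₂ * (D : ℝ) ^ (2 * (dL + 1) * k * nS)) *
          (Real.exp (-(cg / 2 * Hh ^ (-(2 : ℝ)) * τ)) * (1 + τ) ^ Mτ) := by
        rw [hV, hMτ]
        generalize 1 + τ = t
        ring
    _ ≤ C * (P0 ^ k * K) ^ nS * (Hh ^ a * Hh ^ (2 * k * nS)) * ((D : ℝ) ^ a₂ * (D : ℝ) ^ (2 * (dL + 1) * k * nS)) *
          (Kabs * Hh ^ ((2 : ℝ) * Mτ) * Real.exp (-(cg / 2 / 2 * Hh ^ (-(2 : ℝ)) * τ))) :=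
        mul_le_mul_of_nonneg_left habs (by positivity)
    _ = C * (P0 ^ k * K) ^ nS * Kabs * Hh ^ (a + ((2 * k * nS : ℕ) : ℝ) + 2 * (Mτ : ℝ)) * (D : ℝ) ^ (a₂ + ((2 * (dL + 1) * k * nS : ℕ) : ℝ)) *
          (Real.exp (-(cg / 2 / 2 * Hh ^ (-(2 : ℝ)) * τ)) * (1 + τ) ^ 0) := by
        rw [Real.rpow_add hH0, Real.rpow_add hH0, Real.rpow_natCast, Real.rpow_add hD0, Real.rpow_natCast, pow_zero, mul_one]
        ring

end Summit.HodgeConjecture.HodgeConjecture.Cruxes.HLiu418.K2LiuKindOneLineDecayOneFrameRate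

end
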